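import Literature.IUT.LogThetaLattice.TensorPackets
import Literature.RingTheory.Etale.PiTensorProductLocallyEtale
import Mathlib.FieldTheory.IsAlgClosed.AlgebraicClosure
import HarnessLib

/-!
# [IUTchIII] Proposition 3.1 (i) at the MODEL level — proofs (companion B of `TensorPackets.lean`)

Proof-only companion (abc-iut cell, L6 companion seat abc-iut-L6-t5; no new definitions) of
abc-iut-L6-t4's `Literature/IUT/LogThetaLattice/TensorPackets.lean` v4 (p406635), which types the
MODEL level of [IUTchIII] Proposition 3.1 (i) "(Ring Structures)" (S. Mochizuki, *Inter-universal
Teichmüller theory III*, kurims manuscript (May 2020), p. 93 l.3–6; claim key Mochizuki2012,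
DISPUTED, D-0012) as the predicate `Prop31i_locallyProductOfFields 𝕜 L`: every finite subset of
the holomorphic tensor packet `log(^A𝓕_{v_ℚ}) = ⊗_{α∈A} ⊕_{v|v_ℚ} log(^α𝓕_v)` lies in a
`𝕜`-subalgebra ring-isomorphic to a finite product of fields — the faithful reading of the printed
"`log(^A𝓕_{v_ℚ})` … an inductive limit of direct sums of ind-topological fields" at the
Remark 3.1.1 (i) model `log(^α𝓕_v) ≅ k̄` (an INFINITE algebraic extension of `𝕜 = ℚ_{v_ℚ}`), where
the finite-level schema `Prop31i_ringStructures` is false (RQ7 finding L6-F1; L6-lead ruling D10 (a),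
INBOX 2026-08-25T19:29:34Z).

DISCHARGED here for the intended model: finitely many labels `α ∈ A` and places `v ∈ Vfib`, every
`L α v` a field ALGEBRAIC and SEPARABLE over `𝕜` (not necessarily of finite degree) —
`Prop31i_locallyProductOfFields_of_isSeparable`; in characteristic `0` (the case of the text)
algebraicity suffices — `Prop31i_locallyProductOfFields_of_isAlgebraic`; in particular for the
model `L α v := k̄` an algebraic closure of `𝕜`, or of finite extensions `K α v` of `𝕜` —
`Prop31i_locallyProductOfFields_algebraicClosure(_of_finite)`. Classical input:
`Literature/RingTheory/Etale/PiTensorProductLocallyEtale.lean` (finite tensor products of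
ind-(finite étale) algebras over a field are ind-(finite étale); Knus–Merkurjev–Rost–Tignol §18.A).
The ind-topologies and `^αΠ_v`-actions are not modelled (as in the typed file).
-/

namespace Literature.IUT.LogThetaLattice

open scoped TensorProduct
open PiTensorProduct

universe u v v' w

section ModelLevel

variable (𝕜 : Type u) [Field 𝕜]
variable {A : Type v} [Finite A] {Vfib : Type v'} [Finite Vfib]
variable (L : A → Vfib → Type w) [∀ α v, Field (L α v)] [∀ α v, Algebra 𝕜 (L α v)]

/-- **IUTchIII:Prop3.1(i) at the MODEL level** (p. 93 l.3–6, "`log(^A𝓕_{v_ℚ})` … may be regarded as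
an inductive limit of direct sums of ind-topological fields"), DISCHARGED for abc-iut-L6-t4's
model-level predicate: for finitely many labels `α` and places `v | v_ℚ`, if every `log(^α𝓕_v)` is a
field extension of `𝕜 = ℚ_{v_ℚ}` that is algebraic and separable (of possibly INFINITE degree, e.g.
`k̄`), then every finite subset of the tensor packet `⊗_α ⊕_v log(^α𝓕_v)` lies in a `𝕜`-subalgebra
ring-isomorphic to a finite product of (finite separable extension) fields —
`Prop31i_locallyProductOfFields 𝕜 L`. [claim: Mochizuki2012, status: disputed] -/
theorem Prop31i_locallyProductOfFields_of_isSeparable [∀ α v, Algebra.IsSeparable 𝕜 (L α v)] :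
    Prop31i_locallyProductOfFields 𝕜 L := by
  intro s
  obtain ⟨C, hsC, κ, hκ, F, hF, _, -, ⟨e⟩⟩ :=
    Literature.RingTheory.Etale.piTensorProduct_pi_fields_exists_subalgebra_algEquiv_pi_field 𝕜 L s
  exact ⟨C, hsC, κ, hκ, F, hF, ⟨e.toRingEquiv⟩⟩

/-- **IUTchIII:Prop3.1(i) at the MODEL level**, characteristic-zero form (the case of the text:
`𝕜 = ℚ_{v_ℚ}`, so separability is automatic): algebraic field extensions `log(^α𝓕_v)` of `𝕜`, of
any degree, give a tensor packet every finite subset of which lies in a subalgebra ring-isomorphic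
to a finite product of fields. [claim: Mochizuki2012, status: disputed] -/
theorem Prop31i_locallyProductOfFields_of_isAlgebraic [CharZero 𝕜]
    [∀ α v, Algebra.IsAlgebraic 𝕜 (L α v)] : Prop31i_locallyProductOfFields 𝕜 L := by
  have : ∀ α v, Algebra.IsSeparable 𝕜 (L α v) := fun α v => inferInstance
  exact Prop31i_locallyProductOfFields_of_isSeparable 𝕜 L

omit [∀ α v, Field (L α v)] [∀ α v, Algebra 𝕜 (L α v)] in
/-- **The Remark 3.1.1 (i) model `log(^α𝓕_v) ≅ k̄`.** In characteristic `0`, with every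
`log(^α𝓕_v)` an algebraic closure of a finite extension `K α v` of `𝕜 = ℚ_{v_ℚ}` (the completion
of the number field at `v`), the MODEL-level statement of [IUTchIII] Prop. 3.1 (i) holds:
`Prop31i_locallyProductOfFields 𝕜 (fun α v => AlgebraicClosure (K α v))` — whereas the finite-level
schema `Prop31i_ringStructures` must never be assumed there (ruling D10 (a)).
[claim: Mochizuki2012, status: disputed] -/
theorem Prop31i_locallyProductOfFields_algebraicClosure_of_finite [CharZero 𝕜]
    (K : A → Vfib → Type w) [∀ α v, Field (K α v)] [∀ α v, Algebra 𝕜 (K α v)]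
    [∀ α v, FiniteDimensional 𝕜 (K α v)] :
    Prop31i_locallyProductOfFields 𝕜 (fun α v => AlgebraicClosure (K α v)) := by
  have : ∀ α v, Algebra.IsAlgebraic 𝕜 (AlgebraicClosure (K α v)) := fun α v =>
    Algebra.IsAlgebraic.trans 𝕜 (K α v) (AlgebraicClosure (K α v))
  exact Prop31i_locallyProductOfFields_of_isAlgebraic 𝕜 fun α v => AlgebraicClosure (K α v)

omit [∀ α v, Field (L α v)] [∀ α v, Algebra 𝕜 (L α v)] L in
/-- The simplest instance of the model: every factor an algebraic closure `k̄` of `𝕜` itself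
(characteristic `0`). [claim: Mochizuki2012, status: disputed] -/
theorem Prop31i_locallyProductOfFields_algebraicClosure [CharZero 𝕜] :
    Prop31i_locallyProductOfFields 𝕜 (fun (_ : A) (_ : Vfib) => AlgebraicClosure 𝕜) :=
  Prop31i_locallyProductOfFields_of_isAlgebraic 𝕜 fun (_ : A) (_ : Vfib) => AlgebraicClosure 𝕜

end ModelLevel

end Literature.IUT.LogThetaLattice
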